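import Literature.AlgebraicGeometry.ModuliOfAbelianVarieties.SiegelModuliFrameCount
import Literature.AlgebraicGeometry.ModuliOfAbelianVarieties.SiegelFramedCovariant
import Literature.AlgebraicGeometry.AbelianSchemes.PolarizedLevelFrameEmbedding
import Literature.AlgebraicGeometry.AbelianSchemes.AbelianSchemeLDeltaFibreH0Rank
import Literature.AlgebraicGeometry.AbelianSchemes.AbelianSchemeOverFibreIdentity
import Literature.AlgebraicGeometry.Morphisms.ProjectiveSpaceOverAffine
import Literature.AlgebraicGeometry.Motives.MorphismsToProjectiveSpaceBaseChange
import Literature.AlgebraicGeometry.Motives.ProjectiveSpaceFormDivisors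
import Literature.AlgebraicGeometry.Motives.AbelianVarietyTranslatedHyperplaneSections
import Literature.AlgebraicGeometry.Modules.SerreTwistOneOfFrameSections
import Literature.AlgebraicGeometry.Modules.SerreTwistOneAmplePullback
import Literature.AlgebraicGeometry.Modules.SerreTwistModBaseChange
import Literature.AlgebraicGeometry.Modules.CechClassClassPullback
import Literature.AlgebraicGeometry.Modules.ProjectiveFamilyTwistPushforward
import Literature.AlgebraicGeometry.AbelianVarieties.TheoremOfTheSquareCechPic
import Literature.AlgebraicGeometry.Motives.ProjectiveDegreeEqAsympDegree
import Literature.AlgebraicGeometry.Modules.LineBundleSectionIntegral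
import HarnessLib

/-!
# A frame rigidification read over an algebraically closed field: the closed immersion `A ↪ ℙ^m_Ω` with
# `[A ∩ V₊(ℓ)] = [L^Δ(λ)^{⊗3}]`, symmetric hyperplane divisors and `h⁰(n · (A ∩ V₊(ℓ))) = (6n)^g · ∏ δᵢ`

Topic `AlgebraicGeometry/ModuliOfAbelianVarieties`; namespaces `Literature.AlgebraicGeometry.Motives.ProjSpace` (§1) and
`Literature.AlgebraicGeometry.AbelianSchemes.PolarizedAbelianSchemeWithLevel` (§2).  THEOREMS ONLY (no `def`, no instance, no
local instance, no notation, no named fact, no `sorry`).  Cell hodgecm-mathlib (D-0151), F-DAG F-9 name #18 «(O-dict-B)»: the dictionary between a GLOBAL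
FRAME RIGIDIFICATION `ι : X → 𝐏^m_ℤ` of a triple `Q = (A, λ, level)` over `Spec Ω` (★ `PolarizedAbelianSchemeWithLevel.IsFrameRigidification`,
[MumfordFogartyKirwan1994] Ch. 7 §2 Def. 7.5 / Prop. 7.6: «the linear rigidification `𝒪^{m+1} ≅ π_*(L^Δ(λ)³)` embeds `A ⊂ ℙ^m`») and
the CARTIER-DIVISOR currency of the tree's degree files (`ProjSpace.formDivisor … |>.pullbackAvoiding j.left`, ★
`Motives/ProjectiveSpaceHyperplaneSection.hyperplaneSectionOn`), consumed by (O-dict-A) (B-p07 (g18), sockets (P1)–(P6)) and (C4) FILE 2 §B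
(B-p12 (g17)).

* §1 (`Motives.ProjSpace`, any field `K`, any morphism `r : Y → ℙᵈ_K` from an integral scheme) —
  `cechClass_pullbackAvoiding_formDivisor`: `[𝒪_Y(V₊(F)|_Y)] = (r^*[𝒪(H)])^e` in `Ȟ¹(Y, 𝒪_Y^×)` for a form `F` of degree `e` with
  `r(η_Y) ∉ V₊(F)` (★ `CartierDivisor.pullback_cechClass_eq_cechClass_classPullback`, ★ `ProjSpace.smul_hyperplane_linEquiv_formDivisor`);
  `pullback_cechClass_hyperplane_eq_detClass_twistMod`: **`r^*[𝒪(H)] = [𝒪_Y(1)]`**, `𝒪_Y(1) = SerreTwist.twistMod r 𝒪_Y 1`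
  ([Hartshorne1977] II Prop. 5.12 (c); ★ `SerreTwist.nonempty_twistMod_one_id_iso_lineBundle_hyperplane`, ★
  `SerreTwist.exists_pullback_twistMod_unitModule_iso`).
* §2 **`IsFrameRigidification.exists_embedding_over_field`** — for `Q` over `Spec Ω`, `Ω` algebraically closed of characteristic `0`,
  and `hι : Q.IsFrameRigidification J ι`: there is a morphism of `Ω`-schemes `j : B.X ⟶ ℙ^m_Ω` FROM THE ABELIAN VARIETY
  `B := Q.A.toAffine.toAbelianVariety` ITSELF (`B.X = Q.A.X` on the nose, `m = #J`) which is a CLOSED IMMERSION (★ (FS-b)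
  `Polarization.isClosedImmersion_pointOfSections_of_frame_LDelta_three`, [MumfordAV1970] §17 Lefschetz), whose composite with
  `ℙ^m_Ω ≅ 𝐏(J; Spec Ω) → 𝐏^m_ℤ` IS `ι` (for every `ℤ`-algebra structure on `Ω`; ★ `isPullback_projToSpec_projMap_terminal`, ★
  `GeneratingSections.toProj_comp_SpecMap_algebraMap`), with
  `dim B = g` in the height form `height η_B = g` (★ `AbelianVariety.height_genericPoint_eq_dim`), a coordinate hyperplane missing `j(η_B)`,
  and, for EVERY non-zero linear form `ℓ` with `j(η_B) ∉ V₊(ℓ)`, the hyperplane divisor `D_ℓ := V₊(ℓ)|_B`: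
  (sym) `(−1)^*D_ℓ ∼ D_ℓ` and (h⁰) `h⁰(n • D_ℓ) = (6n)^g · ∏ δᵢ` for `n ≥ 1`.  The proof is class bookkeeping in `Ȟ¹(B, 𝒪^×)`:
  `[𝒪(D_ℓ)] = [𝒪_B(1)]` (§1) `= [L^Δ(λ)^{⊗3}]` (★ (V1) `SerreTwist.nonempty_iso_twistMod_one_toProj_ofFrameSystem`, [Hartshorne1977] II
  Thm. 7.1 (a)); on the identity fibre `A ×_Ω Ω ≅ A` (★ `AbelianSchemeOver.fibreIdIso`, an isomorphism of abelian varieties, hence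
  commuting with `−1`) `[L^Δ(λ)^{⊗3}] = [3 • Θ]` with `Θ` symmetric ([MumfordFogartyKirwan1994] Ch. 6 §2 Prop. 6.10, ★
  `Polarization.exists_isAmple_iso_restrict_LDelta_tensorPow_nsmul`); and `h⁰(n • D_ℓ) = dim Γ(A, L^Δ(λ)^{⊗3n}) = (6n)^g ∏ δᵢ` (★ R3
  `Polarization.finrank_secMod_pullback_LDelta_tensorPow`, [MumfordFogartyKirwan1994] Ch. 6 §2 Prop. 6.13, [MumfordAV1970] §16).

* §3 (Edition 2) **`IsFrameRigidification.formDivisor_avoids_genericPoint`** — (P2) NON-DEGENERACY «`j(B)` lies on no hyperplane»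
  ([MumfordFogartyKirwan1994] Ch. 7 §3 Prop. 7.7; the binder `hnd` of ★ `count_lt_of_package`): for `hι` as in §2, ANY `Ω`-morphism
  `j : B.X ⟶ ℙ^m_Ω` satisfying conjunct (ii) and EVERY non-zero linear form `ℓ`, `j(η_B) ∉ V₊(ℓ)` — `j` is forced to be the morphism of
  the frame's generating sections, whose local coefficients are `Ω`-linearly independent (the frame sections are an `Ω`-basis of
  `Γ(B, L^Δ(λ)³)`, and a section of a line bundle on the INTEGRAL `B` vanishing on a non-empty open vanishes, [Hartshorne1977] II
  Prop. 6.15); then ★ `GeneratingSections.formDivisor_avoids_toProj_ofCocycleSections_genericPoint`.  Append-only over edition 1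
  (§§1–2 byte-identical; imports `Motives.ProjectiveDegreeEqAsympDegree`, `Modules.LineBundleSectionIntegral` added).

* §4 (Edition 2, bytes of B-p07 (g19), the (O-dict-A) lineage) **THE (9a) ASSEMBLY — `hF9a` CLOSED**: `count_lt_of_isFrameRigidification`
  (the hyperplane count `hcountQ` of ★ `exists_isFrameOn_of_count` from §2 (i)–(v) + §3 (vi) + ★ #16 (C4) `deg = g!·6^g·d` + ★
  `count_lt_of_package`), `forall_exists_isFrameOn_of_threshold`, and **`exists_threshold_forall_exists_isFrameOn`** = the binder `hF9a`
  of ★ `exists_threshold_siegelFineModuliScheme_of_cores` VERBATIM with `β(g, δ) := 6^g·d·(⌊√(g!)⌋+1) + 1` ([MumfordFogartyKirwan1994]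
  Ch. 7 §3 Prop. 7.7 and Cor. 7.8); folded here zero-name by B-plan1 (g18) U30 (+1 import `ModuliOfAbelianVarieties.SiegelModuliFrameCount`).

HC_CM is proved only modulo the 7 printed citations until rung 0 closes; this file discharges none of them (count-neutral Literature
capital, PROOF lane).

## References
* [MumfordFogartyKirwan1994] D. Mumford, J. Fogarty, F. Kirwan, *Geometric Invariant Theory*, 3rd ed. (1994), Ch. 7 §2 Def. 7.5 (p. 130),
  Prop. 7.6 (p. 136); Ch. 6 §2 Prop. 6.10 (p. 121), Prop. 6.13 (p. 123).
* [Hartshorne1977] R. Hartshorne, *Algebraic Geometry* (1977), II Prop. 5.12 (c) (p. 117), II Thm. 7.1 (a), (b) (p. 150).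
* [MumfordAV1970] D. Mumford, *Abelian Varieties* (1970), §16 (the Riemann–Roch theorem), §17 (the theorem of Lefschetz).
* [GortzWedhorn2020] U. Görtz, T. Wedhorn, *Algebraic Geometry I*, 2nd ed. (2020), Prop. 11.21 (p. 302), Def. 11.49 (p. 315).
* (Edition 2) [MumfordFogartyKirwan1994] Ch. 7 §3 Prop. 7.7 (p. 138); [Hartshorne1977] II Prop. 6.15 (p. 145), II Thm. 7.1 (p. 150).
* (Edition 2, §4) [MumfordFogartyKirwan1994] Ch. 7 §3 Cor. 7.8 (p. 139).
-/

noncomputable section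

-- Mathlib's `Over`/pull-back API and the `Scheme.Modules` section API are stated across semireducible wrappers (as in the tree's
-- ★ `PolarizedLevelFrameEmbedding`, ★ `SerreTwistOneAmplePullback`).
set_option backward.isDefEq.respectTransparency false

open CategoryTheory CategoryTheory.Limits AlgebraicGeometry

universe u

/-! ## §1 `[𝒪_Y(V₊(F)|_Y)] = r^*[𝒪(H)]^e` and `r^*[𝒪(H)] = [𝒪_Y(1)]` -/

namespace Literature.AlgebraicGeometry.Motives

namespace ProjSpace

open Literature.AlgebraicGeometry.Modules Literature.AlgebraicGeometry.Motives.Segre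

variable {d : ℕ} {K : Type u} [Field K] {Y : Scheme.{u}} [IsIntegral Y] (r : Y ⟶ P d K)

/-- **`[𝒪_Y(V₊(F)|_Y)] = (r^*[𝒪(H)])^e` in `Ȟ¹(Y, 𝒪_Y^×)`** for a morphism `r : Y → ℙᵈ_K` from an integral scheme and a form `F` of
degree `e` with `r(η_Y) ∉ V₊(F)`: the pulled-back divisor `V₊(F)|_Y` is the class pull-back of `V₊(F) ∼ e • H` (★
`classPullback_linEquiv_pullbackAvoiding`, ★ `smul_hyperplane_linEquiv_formDivisor`), and class pull-back along ANY morphism is `r^*` on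
`Ȟ¹` (★ `CartierDivisor.pullback_cechClass_eq_cechClass_classPullback`). [cite: GortzWedhorn2020, Prop. 11.21 (p. 302) and Def. 11.49 (p. 315)] -/
theorem cechClass_pullbackAvoiding_formDivisor {e : ℕ} {F : MvPolynomial (Fin (d + 1)) K} (hF : F ∈ grading (Fin (d + 1)) K e)
    (hF0 : F ≠ 0) (h : (formDivisor F hF hF0).Avoids (r (genericPoint Y))) :
    ((formDivisor F hF hF0).pullbackAvoiding r h).cechClass = CechPic.pullback r (hyperplane d K).cechClass ^ e := by
  rw [← ((formDivisor F hF hF0).classPullback_linEquiv_pullbackAvoiding r h).cechClass_eq,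
    ← CartierDivisor.pullback_cechClass_eq_cechClass_classPullback, ← (smul_hyperplane_linEquiv_formDivisor hF hF0).cechClass_eq,
    AbelianSchemes.cechClass_smul', map_pow]

omit [IsIntegral Y] in
/-- **`r^*[𝒪(H)] = [𝒪_Y(1)]`** ([Hartshorne1977] II Prop. 5.12 (c): `r^*𝒪_{ℙ}(1) = 𝒪_Y(1)`): the pull-back of the class of the
hyperplane divisor along `r : Y → ℙᵈ_K` is the determinant class of the positive Serre twist `𝒪_Y(1) = SerreTwist.twistMod r 𝒪_Y 1`
(`𝒪_{ℙ}(1) ≅ 𝒪(H)`, ★ `SerreTwist.nonempty_twistMod_one_id_iso_lineBundle_hyperplane`; `r^*𝒪_{ℙ}(1) ≅ 𝒪_Y(1)`, ★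
`SerreTwist.exists_pullback_twistMod_unitModule_iso`; classes of isomorphic modules agree, ★ `detClass_eq_of_iso`).
[cite: Hartshorne1977, II Prop. 5.12 (c) (p. 117)] [cite: GortzWedhorn2020, Prop. 11.21 (p. 302)] -/
theorem pullback_cechClass_hyperplane_eq_detClass_twistMod :
    CechPic.pullback r (hyperplane d K).cechClass = detClass (isFiniteLocallyFree_twistMod_unitModule r 1) := by
  obtain ⟨φ⟩ := SerreTwist.nonempty_twistMod_one_id_iso_lineBundle_hyperplane d K
  obtain ⟨ψ, -⟩ := SerreTwist.exists_pullback_twistMod_unitModule_iso r (𝟙 (P d K)) 1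
  have e₁ : SerreTwist.twistMod (r ≫ 𝟙 (P d K)) (unitModule Y) 1 ≅ SerreTwist.twistMod r (unitModule Y) 1 :=
    eqToIso (by rw [Category.comp_id])
  rw [← detClass_lineBundle_toUnitCocycle, ← detClass_eq_of_iso φ (isFiniteLocallyFree_twistMod_unitModule (𝟙 (P d K)) 1)
      (hyperplane d K).toUnitCocycle.isFiniteLocallyFree_lineBundle,
    ← detClass_pullback r (isFiniteLocallyFree_twistMod_unitModule (𝟙 (P d K)) 1),
    detClass_eq_of_iso (ψ ≪≫ e₁) ((isFiniteLocallyFree_twistMod_unitModule (𝟙 (P d K)) 1).pullback r)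
      (isFiniteLocallyFree_twistMod_unitModule r 1)]

/-- `dim_L Γ(Y, G)` through `ρ ∘ ΓSpecIso⁻¹ : L → Γ(Y, 𝒪)` equals `dim_{Γ(Spec L, 𝒪)} Γ(Y, G)` through `ρ` (the two scalar rings are
identified by `ΓSpecIso`; the same bridge as in ★ `AbelianSchemeLDeltaFibreH0Rank` §2, where it is private). [folklore] -/
private theorem finrank_secMod_comp_ΓSpecIso_inv_eq {L : Type} [Field L] {Y : Scheme.{0}} (ρ : Γ(Spec (.of L), ⊤) →+* Γ(Y, ⊤))
    (G : Y.Modules) :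
    Module.finrank L (SecMod G (ρ.comp (Scheme.ΓSpecIso (.of L)).inv.hom) ⊤) = Module.finrank Γ(Spec (.of L), ⊤) (SecMod G ρ ⊤) := by
  refine congrArg Cardinal.toNat (rank_eq_of_equiv_equiv (Scheme.ΓSpecIso (.of L)).inv
    (AddEquiv.refl _) (Scheme.ΓSpecIso (.of L)).symm.commRingCatIsoToRingEquiv.bijective fun c m => ?_)
  rfl

end ProjSpace

end Literature.AlgebraicGeometry.Motives

/-! ## §2 The frame rigidification over `Spec Ω`: the closed immersion `B ↪ ℙ^m_Ω` and its hyperplane divisors -/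

namespace Literature.AlgebraicGeometry.AbelianSchemes

namespace PolarizedAbelianSchemeWithLevel

open Literature.AlgebraicGeometry.Motives Literature.AlgebraicGeometry.Modules Literature.AlgebraicGeometry.AbelianVarieties
open Literature.AlgebraicGeometry.Morphisms (intU projectiveSpaceInt isPullback_projToSpec_projMap_terminal)
open Literature.AlgebraicGeometry.ModuliOfAbelianVarieties (polarizationDegree)
open MvPolynomial (X)

variable {g N : ℕ} {δ : Fin g → ℕ} {J : Type} {Ω : Type} [Field Ω] [CharZero Ω] [IsAlgClosed Ω]
  (Q : PolarizedAbelianSchemeWithLevel g N δ (Spec (.of Ω))) {ι : Q.A.X.left ⟶ projectiveSpaceInt J}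

/-- **(O-dict-B) A frame rigidification over an algebraically closed field of characteristic `0`, read as a closed immersion of the
abelian variety with its hyperplane divisors.**  For a triple `Q = (A, λ, level)` over `Spec Ω` and the morphism `ι : A → 𝐏^m_ℤ` of a
GLOBAL frame of `π_*(L^Δ(λ)^{⊗3})` (`m = #J`), with `B := Q.A.toAffine.toAbelianVariety` (so `B.X = Q.A.X`): there is an `Ω`-morphism
`j : B.X ⟶ ℙ^m_Ω` such that
(i) `j` is a CLOSED IMMERSION ([MumfordFogartyKirwan1994] Prop. 7.6 / [MumfordAV1970] §17: `L^Δ(λ)³` is very ample);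
(ii) `j` followed by `ℙ^m_Ω = Proj Ω[x] ≅ 𝐏(J; Spec Ω) → 𝐏^m_ℤ` (★ `isPullback_projToSpec_projMap_terminal`, i.e. by ★
`projectiveSpaceSpec_isoPullback_hom_snd` the base-change morphism `Proj.map (ℤ[x] → Ω[x])`) is `ι`, for every `ℤ`-algebra structure
on `Ω` (e.g. `(GeneralLinearGroupScheme.intCast Ω).toAlgebra`);
(iii) `height η_B = g` (`dim B = g`);
(iv) some coordinate hyperplane `V₊(x_{a₀})` misses `j(η_B)`;
(v) for every non-zero linear form `ℓ` with `j(η_B) ∉ V₊(ℓ)`, the hyperplane divisor `D_ℓ := V₊(ℓ)|_B` is SYMMETRIC, `(−1)^*D_ℓ ∼ D_ℓ`,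
and `h⁰(n • D_ℓ) = (6n)^g · ∏ δᵢ` for all `n ≥ 1` ([MumfordFogartyKirwan1994] Prop. 6.13: `6^g ∏δᵢ = m + 1` sections of `L^Δ(λ)³`).
[cite: MumfordFogartyKirwan1994, Ch. 7 §2 Def. 7.5 (p. 130) and Prop. 7.6 (p. 136)] [cite: MumfordFogartyKirwan1994, Ch. 6 §2 Prop. 6.10 (p. 121) and Prop. 6.13 (p. 123)]
[cite: Hartshorne1977, II Thm. 7.1 (a) (p. 150)] [cite: MumfordAV1970, §16 and §17] -/
theorem IsFrameRigidification.exists_embedding_over_field (hι : Q.IsFrameRigidification J ι) :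
    ∃ (j : Q.A.toAffine.toAbelianVariety.X ⟶ Motives.projectiveSpace (Nat.card J) Ω) (_ : IsClosedImmersion j.left),
      (∀ [Algebra intU.{0} Ω], j.left ≫ (isPullback_projToSpec_projMap_terminal J Ω).isoPullback.hom ≫
          pullback.snd (terminal.from (Spec (.of Ω))) (terminal.from (projectiveSpaceInt J)) = ι) ∧
      Order.height (genericPoint ↥Q.A.toAffine.toAbelianVariety.X.left) = (g : ℕ∞) ∧
      (∃ a₀ : Fin (Nat.card J + 1), (ProjSpace.formDivisor (X a₀) (Segre.X_mem Ω a₀) (MvPolynomial.X_ne_zero a₀)).Avoids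
        (j.left.base (genericPoint ↥Q.A.toAffine.toAbelianVariety.X.left))) ∧
      ∀ (ℓ : MvPolynomial (Fin (Nat.card J + 1)) Ω) (hℓ : ℓ ∈ Segre.grading (Fin (Nat.card J + 1)) Ω 1) (hℓ0 : ℓ ≠ 0)
        (h : (ProjSpace.formDivisor ℓ hℓ hℓ0).Avoids (j.left.base (genericPoint ↥Q.A.toAffine.toAbelianVariety.X.left))),
        (((ProjSpace.formDivisor ℓ hℓ hℓ0).pullbackAvoiding j.left h).pullback
            (AbelianVariety.Hom.toSchemeHom (-𝟙 Q.A.toAffine.toAbelianVariety))).LinEquiv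
          ((ProjSpace.formDivisor ℓ hℓ hℓ0).pullbackAvoiding j.left h) ∧
        ∀ n : ℕ, 0 < n →
          (n • (ProjSpace.formDivisor ℓ hℓ hℓ0).pullbackAvoiding j.left h).h0 Ω = (6 * n) ^ g * polarizationDegree δ := by
  classical
  obtain ⟨Gr, hGr₁, hGr₂, F, h1, e, hcov, hpt⟩ := hι
  rw [Morphisms.projectiveSpace.homEquiv_pointOfSections] at hpt
  -- the abelian variety, the generating sections of the frame, the `Ω`-morphism they define
  let B : AbelianVariety Ω := Q.A.toAffine.toAbelianVariety
  let G : GeneratingSections (Fin (Nat.card J + 1)) B.X.left :=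
    GeneratingSections.ofCocycleSections F.U (GeneratingSections.CocycleSections.ofFrameSystem F h1 fun j ↦ (basisSection e j :)) hcov
  let j : B.X ⟶ Motives.projectiveSpace (Nat.card J) Ω := G.toProjectiveSpace
  have hjl : j.left = G.toProj Q.A.X.hom := rfl
  -- (ii) the chart link, for every `ℤ`-algebra structure
  have hP6 : ∀ [Algebra intU.{0} Ω], j.left ≫ (isPullback_projToSpec_projMap_terminal J Ω).isoPullback.hom ≫
      pullback.snd (terminal.from (Spec (.of Ω))) (terminal.from (projectiveSpaceInt J)) = ι := by
    intro _
    rw [IsPullback.isoPullback_hom_snd, hjl, ← hpt, ← GeneratingSections.toProj_comp_SpecMap_algebraMap]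
    congr 1
    exact specULiftZIsTerminal.hom_ext _ _
  -- (i) closed immersion: `j` is the (FS-b) closed immersion `A ↪ 𝐏(J; Spec Ω)` read through `Proj Ω[x] ≅ 𝐏(J; Spec Ω)`
  haveI : IsLocallyNoetherian (Spec (.of Ω)) := inferInstance
  obtain ⟨hcov', hci⟩ := Q.pol.isClosedImmersion_pointOfSections_of_frame_LDelta_three Q.A Q.D
    (Spec.map (CommRingCat.ofHom (algebraMap ℚ Ω))) Gr hGr₁ hGr₂ F h1 J e
  have hjci : IsClosedImmersion j.left := by
    letI : Algebra intU.{0} Ω := ULift.algebra' ℤ Ω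
    have hsq : j.left ≫ (isPullback_projToSpec_projMap_terminal J Ω).isoPullback.hom =
        (Morphisms.projectiveSpace.pointOfSections (Over.mk Q.A.X.hom) G).left := by
      rw [Morphisms.projectiveSpace.pointOfSections, Morphisms.projectiveSpace.homEquiv_symm_apply_left]
      apply pullback.hom_ext
      · rw [Category.assoc, IsPullback.isoPullback_hom_fst, pullback.lift_fst, hjl]
        exact G.toProj_toSpec Q.A.X.hom
      · rw [Category.assoc, pullback.lift_snd]
        exact hP6.trans hpt.symm
    have hj' : j.left = (Morphisms.projectiveSpace.pointOfSections (Over.mk Q.A.X.hom) G).left ≫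
        (isPullback_projToSpec_projMap_terminal J Ω).isoPullback.inv := by
      rw [← hsq, Category.assoc, Iso.hom_inv_id, Category.comp_id]
    rw [hj']
    haveI := hci
    infer_instance
  -- (iii) `dim B = g`
  have hdimB : B.dim = g := by
    haveI : Nonempty ↥Q.A.toAffine.X.left := ⟨AbelianVariety.origin B⟩
    exact AbelianVarietyProofs.eq_of_smoothOfRelativeDimension _ Q.A.toAffine.isOfRelDim_dim Q.relDim
  have hdim : Order.height (genericPoint ↥B.X.left) = (g : ℕ∞) := by
    have h : (Order.height (genericPoint ↥B.X.left) : WithBot ℕ∞) = B.dim := by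
      rw [Scheme.height_genericPoint, AbelianVariety.topologicalKrullDim_left]
    rw [← hdimB]
    exact_mod_cast h
  -- (iv) a coordinate hyperplane missing `j(η)`
  have ha₀ : ∃ a₀ : Fin (Nat.card J + 1), (ProjSpace.formDivisor (X a₀) (Segre.X_mem Ω a₀) (MvPolynomial.X_ne_zero a₀)).Avoids
      (j.left.base (genericPoint ↥B.X.left)) := by
    obtain ⟨l, hl⟩ := ProjSpace.exists_X_notMem (d := Nat.card J) (K := Ω) (j.left.base (genericPoint ↥B.X.left))
    exact ⟨l, (ProjSpace.formDivisor_avoids_iff _ _ zero_lt_one).2 hl⟩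
  -- ranks and local freeness of `L^Δ(λ)` and its cube
  -- (read as modules on `B.X.left`, which is `Q.A.X.left` on the nose, so that all classes live in ONE `Ȟ¹(B, 𝒪^×)`)
  have hLΔ₁ : HasRank (X := B.X.left) ((Scheme.Modules.pullback Gr).obj Q.D.P) 1 := hasRank_pullback Gr Q.D.hasRank_one
  have hF : IsFiniteLocallyFree (X := B.X.left) ((Scheme.Modules.pullback Gr).obj Q.D.P) := HasRank.isFiniteLocallyFree' hLΔ₁
  have hE3 : IsFiniteLocallyFree (X := B.X.left) (tensorPow ((Scheme.Modules.pullback Gr).obj Q.D.P) 3) :=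
    isFiniteLocallyFree_tensorPow hF 3
  -- KEY: `[𝒪_B(V₊(ℓ)|_B)] = [L^Δ(λ)^{⊗3}]` in `Ȟ¹(B, 𝒪^×)` (§1 + (V1))
  have hkey : ∀ (ℓ : MvPolynomial (Fin (Nat.card J + 1)) Ω) (hℓ : ℓ ∈ Segre.grading (Fin (Nat.card J + 1)) Ω 1) (hℓ0 : ℓ ≠ 0)
      (h : (ProjSpace.formDivisor ℓ hℓ hℓ0).Avoids (j.left.base (genericPoint ↥B.X.left))),
      ((ProjSpace.formDivisor ℓ hℓ hℓ0).pullbackAvoiding j.left h).cechClass = detClass hE3 := by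
    intro ℓ hℓ hℓ0 h
    obtain ⟨φV⟩ := SerreTwist.nonempty_iso_twistMod_one_toProj_ofFrameSystem F h1 _ hcov Q.A.X.hom
    rw [ProjSpace.cechClass_pullbackAvoiding_formDivisor, pow_one, ProjSpace.pullback_cechClass_hyperplane_eq_detClass_twistMod,
      ← detClass_eq_of_iso φV hE3]
  -- the identity fibre `A ×_Ω Ω ≅ A` as abelian varieties, and a symmetric `Θ` with `ι_𝟙^*(L^Δ(λ)^{⊗3}) ≅ 𝒪(3 • Θ)` on it
  let eB := AbelianSchemeOver.fibreIdIso Q.A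
  let jf : (Q.A.fibre (𝟙 _)).toAbelianVariety.X.left ⟶ B.X.left := AbelianVariety.Hom.toSchemeHom eB.hom
  have hjf : jf = pullback.fst Q.A.X.hom (𝟙 _) := AbelianSchemeOver.fibreIdToGrpIso_hom_left Q.A
  haveI : IsIso jf := by rw [hjf]; exact AbelianSchemeOver.isIso_pullback_fst_id _
  obtain ⟨Θ, -, hΘsym, ⟨ψ⟩⟩ := Q.pol.exists_isAmple_iso_restrict_LDelta_tensorPow_nsmul Q.A Q.D (𝟙 _) hjf Gr hGr₁ hGr₂ 3
  have hfib : CechPic.pullback jf (detClass hE3) = (3 • Θ).cechClass := by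
    rw [← detClass_pullback jf hE3, detClass_eq_of_iso ψ (hE3.pullback jf) (3 • Θ).toUnitCocycle.isFiniteLocallyFree_lineBundle,
      detClass_lineBundle_toUnitCocycle]
  -- `−1` commutes with the identification of the identity fibre (an isomorphism of abelian varieties)
  let νf := AbelianVariety.Hom.toSchemeHom (-𝟙 (Q.A.fibre (𝟙 (Spec (.of Ω)))).toAbelianVariety)
  let νB := AbelianVariety.Hom.toSchemeHom (-𝟙 B)
  have hG : jf ≫ νB = νf ≫ jf := by
    change AbelianVariety.Hom.toSchemeHom (eB.hom ≫ (-𝟙 B)) = AbelianVariety.Hom.toSchemeHom ((-𝟙 _) ≫ eB.hom)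
    rw [Preadditive.comp_neg, Preadditive.neg_comp, Category.comp_id, Category.id_comp]
  have hinj : Function.Injective (CechPic.pullback jf) := by
    intro a b hab
    have h' := congrArg (CechPic.pullback (inv jf)) hab
    rwa [← CechPic.pullback_comp, ← CechPic.pullback_comp, IsIso.inv_hom_id, CechPic.pullback_id, CechPic.pullback_id] at h'
  refine ⟨j, hjci, hP6, hdim, ha₀, fun ℓ hℓ hℓ0 h ↦ ⟨?_, fun n hn ↦ ?_⟩⟩
  · -- (v, sym): compare classes after pulling back to the identity fibre, where `D_ℓ ∼ 3 • Θ` with `Θ` symmetric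
    have hD : (((ProjSpace.formDivisor ℓ hℓ hℓ0).pullbackAvoiding j.left h).pullback jf).cechClass = (3 • Θ).cechClass := by
      rw [CartierDivisor.cechClass_pullback, hkey, hfib]
    rw [← CartierDivisor.cechClass_eq_iff_linEquiv]
    apply hinj
    rw [← CartierDivisor.cechClass_pullback, ← CartierDivisor.cechClass_pullback,
      (CartierDivisor.pullback_pullback_sameDivisor _ νB jf).cechClass_eq, (CartierDivisor.pullback_congr_sameDivisor _ hG).cechClass_eq,
      ← (CartierDivisor.pullback_pullback_sameDivisor _ jf νf).cechClass_eq, CartierDivisor.cechClass_pullback, hD,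
      ← CartierDivisor.cechClass_pullback, CartierDivisor.pullback_smul, cechClass_smul', cechClass_smul', hΘsym.cechClass_eq]
  · -- (v, h⁰): `𝒪(n • D_ℓ) ≅ L^Δ(λ)^{⊗3n}` (classes), then ★ R3 at the cartesian square `(𝟙, π; π, 𝟙)`
    have hcl : detClass (n • (ProjSpace.formDivisor ℓ hℓ hℓ0).pullbackAvoiding j.left h).toUnitCocycle.isFiniteLocallyFree_lineBundle =
        detClass ((isFiniteLocallyFree_tensorPow hF (3 * n)).pullback (𝟙 B.X.left)) := by
      rw [detClass_lineBundle_toUnitCocycle, cechClass_smul', hkey, detClass_pullback (𝟙 B.X.left) (isFiniteLocallyFree_tensorPow hF (3 * n)),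
        CechPic.pullback_id,
        detClass_tensorPow hLΔ₁ hF 3 hE3, detClass_tensorPow hLΔ₁ hF (3 * n), ← pow_mul]
    obtain ⟨eM⟩ := (nonempty_iso_iff_detClass_eq (UnitCocycle.hasRank_lineBundle _)
      (hasRank_pullback (𝟙 B.X.left) (hasRank_tensorPow_one hLΔ₁ (3 * n))) _ _).2 hcl
    rw [← CartierDivisor.finrank_secMod_lineBundle_eq_h0 B.X]
    obtain ⟨Lin, -⟩ := Morphisms.exists_secMod_linearEquiv_of_iso (B.X.hom.appTop.hom.comp (Scheme.ΓSpecIso (.of Ω)).inv.hom) eM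
    rw [Lin.finrank_eq, ProjSpace.finrank_secMod_comp_ΓSpecIso_inv_eq]
    have H : IsPullback (𝟙 B.X.left) Q.A.X.hom Q.A.X.hom (𝟙 (Spec (.of Ω))) := IsPullback.of_horiz_isIso ⟨by simp⟩
    have h3n : 0 < 3 * n := by omega
    have h6 : (2 * (3 * n)) ^ g * polarizationDegree δ = (6 * n) ^ g * polarizationDegree δ := by ring
    exact (Q.pol.finrank_secMod_pullback_LDelta_tensorPow Q.A Q.D Q.relDim Q.hasType Gr hGr₁ hGr₂ (𝟙 _) H h3n).trans h6

end PolarizedAbelianSchemeWithLevel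

end Literature.AlgebraicGeometry.AbelianSchemes

end

noncomputable section

set_option backward.isDefEq.respectTransparency false

open CategoryTheory CategoryTheory.Limits AlgebraicGeometry

/-! ## §3 (Edition 2) Non-degeneracy: `j(η_B)` lies on no hyperplane -/

namespace Literature.AlgebraicGeometry.AbelianSchemes

namespace PolarizedAbelianSchemeWithLevel

open Literature.AlgebraicGeometry.Motives Literature.AlgebraicGeometry.Modules Literature.AlgebraicGeometry.AbelianVarieties
open Literature.AlgebraicGeometry.Morphisms (intU projectiveSpaceInt isPullback_projToSpec_projMap_terminal)

variable {g N : ℕ} {δ : Fin g → ℕ} {J : Type} {Ω : Type} [Field Ω]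
  (Q : PolarizedAbelianSchemeWithLevel g N δ (Spec (.of Ω))) {ι : Q.A.X.left ⟶ projectiveSpaceInt J}

/-- **(P2) NON-DEGENERACY of the frame embedding: `j(B)` lies on no hyperplane** ([MumfordFogartyKirwan1994] Ch. 7 §3
Prop. 7.7, the hypothesis «`Φ(A)` is not contained in any hyperplane of `ℙ^m`» — automatic for the embedding of a LINEAR
RIGIDIFICATION, whose homogeneous coordinates pull back to a BASIS of `Γ(A, L^Δ(λ)³)`; the binder `hnd` of ★ `count_lt_of_package`).
For `hι : Q.IsFrameRigidification J ι` over `Spec Ω` (`Ω` any field) and ANY `Ω`-morphism `j : B.X ⟶ ℙ^m_Ω`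
(`B := Q.A.toAffine.toAbelianVariety`) whose composite with `ℙ^m_Ω ≅ 𝐏(J; Spec Ω) → 𝐏^m_ℤ` is `ι` (conjunct (ii) of ★
`exists_embedding_over_field`), every non-zero linear form `ℓ` misses `j(η_B)`: the divisor `V₊(ℓ)` AVOIDS the image of the generic
point.  Proof: `j` is the morphism of the generating sections of the frame (a morphism to `𝐏(J; Spec Ω) = Spec Ω × 𝐏^m_ℤ` is
determined by its two components; ★ `toProj_toSpec`, ★ `toProj_comp_SpecMap_algebraMap`), so ★
`GeneratingSections.formDivisor_avoids_toProj_ofCocycleSections_genericPoint` ([Hartshorne1977] II Thm. 7.1) applies once the local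
coefficients `λ_{x₀}(b_k)` of the frame sections `b_k = basisSection e k` on a trivialising open `U_{x₀} ∋ η_B` are `Ω`-linearly
independent: a relation `Σ r_k λ_{x₀}(b_k) = 0` says that the global section `Σ r_k b_k` of the LINE BUNDLE `L^Δ(λ)³` vanishes on
`U_{x₀}` (★ `coeffAt_sum_smul`, ★ `map_top_eq_coeffAt_smul`), hence vanishes, `B` being INTEGRAL (★ `resTop_eq_zero_iff_of_isIntegral`,
[Hartshorne1977] II Prop. 6.15), hence `r = 0`, the `b_k` being a `Γ(Spec Ω, 𝒪)`-basis of `Γ(Spec Ω, π_*L^Δ(λ)³) = Γ(B, L^Δ(λ)³)`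
(★ `coord_sum_smul_basisSection`).
[cite: MumfordFogartyKirwan1994, Ch. 7 §3 Prop. 7.7 (p. 138)] [cite: Hartshorne1977, II Thm. 7.1 (p. 150)]
[cite: Hartshorne1977, II Prop. 6.15 (p. 145)] -/
theorem IsFrameRigidification.formDivisor_avoids_genericPoint (hι : Q.IsFrameRigidification J ι)
    (j : Q.A.toAffine.toAbelianVariety.X ⟶ Motives.projectiveSpace (Nat.card J) Ω) [Algebra intU.{0} Ω]
    (hj : j.left ≫ (isPullback_projToSpec_projMap_terminal J Ω).isoPullback.hom ≫
        pullback.snd (terminal.from (Spec (.of Ω))) (terminal.from (projectiveSpaceInt J)) = ι)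
    (ℓ : MvPolynomial (Fin (Nat.card J + 1)) Ω) (hℓ : ℓ ∈ Segre.grading (Fin (Nat.card J + 1)) Ω 1) (hℓ0 : ℓ ≠ 0) :
    (ProjSpace.formDivisor ℓ hℓ hℓ0).Avoids (j.left.base (genericPoint ↥Q.A.toAffine.toAbelianVariety.X.left)) := by
  classical
  obtain ⟨Gr, hGr₁, hGr₂, F, h1, e, hcov, hpt⟩ := hι
  rw [Morphisms.projectiveSpace.homEquiv_pointOfSections] at hpt
  -- the abelian variety, the frame sections, their coefficients, the generating sections, the morphism they define
  let B : AbelianVariety Ω := Q.A.toAffine.toAbelianVariety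
  haveI : IsIntegral Q.A.X.left := inferInstanceAs (IsIntegral B.X.left)
  let E : B.X.left.Modules := tensorPow ((Scheme.Modules.pullback Gr).obj Q.D.P) 3
  let t : Fin (Nat.card J + 1) → Γ(E, ⊤) := fun k ↦ (basisSection e k :)
  let S : GeneratingSections.CocycleSections (Fin (Nat.card J + 1)) F.U :=
    GeneratingSections.CocycleSections.ofFrameSystem F h1 t
  let G : GeneratingSections (Fin (Nat.card J + 1)) B.X.left := GeneratingSections.ofCocycleSections F.U S hcov
  -- (1) `j` IS the morphism of the generating sections: both components of `B → Spec Ω × 𝐏^m_ℤ` agree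
  have key : j.left = G.toProj Q.A.X.hom := by
    rw [← cancel_mono (isPullback_projToSpec_projMap_terminal J Ω).isoPullback.hom]
    apply pullback.hom_ext
    · rw [Category.assoc, Category.assoc, IsPullback.isoPullback_hom_fst]
      exact (Over.w j).trans (G.toProj_toSpec Q.A.X.hom).symm
    · rw [Category.assoc, Category.assoc, hj, IsPullback.isoPullback_hom_snd, ← hpt,
        ← GeneratingSections.toProj_comp_SpecMap_algebraMap]
      congr 1
      exact specULiftZIsTerminal.hom_ext _ _
  -- (2) a trivialising open `U_{x₀}` of the frame system containing the generic point, with `η ∈ B_{λ_{x₀}(b_i)}`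
  have hη : genericPoint ↥Q.A.X.left ∈ (⊤ : Q.A.X.left.Opens) := TopologicalSpace.Opens.mem_top _
  rw [← hcov] at hη
  obtain ⟨i, hi⟩ := TopologicalSpace.Opens.mem_iSup.1 hη
  obtain ⟨x₀, hx₀⟩ := TopologicalSpace.Opens.mem_iSup.1 hi
  -- (3) the local coefficients of the frame sections at `x₀` are `Ω`-linearly independent
  have hE1 : HasRank (X := B.X.left) E 1 := hasRank_tensorPow_one (hasRank_pullback Gr Q.D.hasRank_one) 3
  haveI : Nonempty (F.U x₀) := ⟨⟨x₀, F.mem x₀⟩⟩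
  haveI : Nonempty ((F.U x₀ : Set ↥Q.A.X.left) : Type) := ⟨⟨x₀, F.mem x₀⟩⟩
  have hind : ∀ r : Fin (Nat.card J + 1) → Ω,
      (∑ k, Q.A.X.left.presheaf.map (homOfLE (le_top : F.U x₀ ≤ ⊤)).op (Segre.pull Q.A.X.hom (r k)) *
        S.coeff k x₀) = 0 → r = 0 := by
    intro r hr
    -- the global section `σ = Σ r_k b_k` has coefficient `Σ r_k λ_{x₀}(b_k) = 0` at `x₀`, so vanishes on `U_{x₀}`
    let σ : Γ(E, ⊤) := ∑ k, Segre.pull Q.A.X.hom (r k) • t k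
    have hσdef : (fun _ : Unit ↦ σ) () = ∑ k ∈ Finset.univ, Segre.pull Q.A.X.hom (r k) • t k := rfl
    have hcoeff : GeneratingSections.coeffAt F h1 (fun _ : Unit ↦ σ) () x₀ = 0 := by
      rw [GeneratingSections.coeffAt_sum_smul F h1 Finset.univ (fun k ↦ Segre.pull Q.A.X.hom (r k)) t
        (fun _ : Unit ↦ σ) () hσdef x₀]
      exact hr
    have hσU : resTop E σ (F.U x₀) = 0 := by
      change E.presheaf.map (homOfLE (le_top : F.U x₀ ≤ ⊤)).op ((fun _ : Unit ↦ σ) ()) = 0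
      rw [GeneratingSections.map_top_eq_coeffAt_smul F h1 (fun _ : Unit ↦ σ) () x₀, hcoeff, zero_smul]
    -- `B` integral, `E` a line bundle: `σ = 0`
    have hσ0 : σ = 0 :=
      (resTop_eq_zero_iff_of_isIntegral (Equiv.refl (Fin 1)) (exists_frame_of_hasRank_one hE1 (Equiv.refl (Fin 1)))
        σ (F.U x₀)).1 hσU
    -- the `b_k` are a `Γ(Spec Ω, 𝒪)`-basis of `Γ(Spec Ω, π_*E) = Γ(B, E)`: read `σ` in the frame `e`
    have hσe : (show Γ((Scheme.Modules.pushforward Q.A.X.hom).obj E, ⊤) from σ) =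
        ∑ k, (Scheme.ΓSpecIso (.of Ω)).inv (r k) •
          ((Scheme.Modules.pushforward Q.A.X.hom).obj E).presheaf.map (𝟙 (⊤ : (Spec (.of Ω)).Opens)).op
            (basisSection e k) := by
      refine Finset.sum_congr rfl fun k _ ↦ ?_
      rw [presheaf_map_id]
      rfl
    funext k
    have hc := coord_sum_smul_basisSection e (𝟙 ⊤) (fun k ↦ (Scheme.ΓSpecIso (.of Ω)).inv (r k)) k
    rw [← hσe] at hc
    have hz : coord e (𝟙 ⊤) (show Γ((Scheme.Modules.pushforward Q.A.X.hom).obj E, ⊤) from σ) k = 0 := by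
      rw [show (show Γ((Scheme.Modules.pushforward Q.A.X.hom).obj E, ⊤) from σ) = 0 from hσ0]
      exact coord_zero e (𝟙 ⊤) k
    rw [hz] at hc
    have h' := congrArg (Scheme.ΓSpecIso (.of Ω)).hom hc
    rw [map_zero, ← CategoryTheory.comp_apply, Iso.inv_hom_id] at h'
    exact h'.symm
  -- (4) the generic lemma
  rw [key]
  exact GeneratingSections.formDivisor_avoids_toProj_ofCocycleSections_genericPoint Q.A.X.hom S hcov i x₀
    ⟨genericPoint ↥B.X.left, hx₀⟩ hind hℓ hℓ0

end PolarizedAbelianSchemeWithLevel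

end Literature.AlgebraicGeometry.AbelianSchemes

end

/-!
## §4 (Edition 2; bytes of B-p07 (g19), folded here zero-name per B-plan1 (g18) U30): the (9a) ASSEMBLY — `hcount` from the
package, `hcov` above the threshold, and the F-12 core `hF9a` CLOSED

[MumfordFogartyKirwan1994] Ch. 7 §3 Prop. 7.7 with Cor. 7.8's bound `n > 6^g·d·√(g!)`: assembling ★ #18 (O-dict-B)
`IsFrameRigidification.exists_embedding_over_field` ((i)–(v)) and `IsFrameRigidification.formDivisor_avoids_genericPoint` ((vi),
B-p08 (g14)), ★ #16 (C4) `ProjSpace.degree_hyperplaneSection_iter_fundamental_eq_of_forall_h0_eq` (`deg = g!·6^g·d`, B-p04 (g21)),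
`card_mul_lt_sq_of_threshold` and (O-dict-A) `count_lt_of_package` into the count `hcountQ`, hence `hcov`, hence the binder
`hF9a` of ★ `exists_threshold_siegelFineModuliScheme_of_cores` with `β(g, δ) := 6^g·d·(⌊√(g!)⌋+1) + 1`.
-/

noncomputable section

set_option backward.isDefEq.respectTransparency false

open CategoryTheory CategoryTheory.Limits AlgebraicGeometry Order
open MvPolynomial (X)
open Literature.AlgebraicGeometry.Motives.Segre
open Literature.AlgebraicGeometry.Motives.GeneratingSections (preU homRatio rs)
open Literature.AlgebraicGeometry.Morphisms (intU projectiveSpaceInt projectiveSpaceSpec_isoPullback_hom_snd)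
open Literature.AlgebraicGeometry.GroupSchemes.GeneralLinearGroupScheme (intCast)

namespace Literature.AlgebraicGeometry.AbelianSchemes

namespace PolarizedAbelianSchemeWithLevel

open Literature.AlgebraicGeometry.Motives Literature.AlgebraicGeometry.Motives.ProjSpace
open Literature.AlgebraicGeometry.ModuliOfAbelianVarieties (polarizationDegree IsPolarizationType)

variable {g N : ℕ} {δ : Fin g → ℕ} (J : Type)

/-- `m + 1 = 6^g·d` with `g ≥ 1` forces `m ≥ 1`. [cite: MumfordFogartyKirwan1994, Ch. 7 §2 Def. 7.5 (p. 130)] -/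
theorem one_le_card_of_card_add_one_eq (hg : 0 < g) (hJ : Nat.card J + 1 = 6 ^ g * polarizationDegree δ) :
    1 ≤ Nat.card J := by
  have hd : polarizationDegree δ ≠ 0 := fun h => by rw [h, mul_zero] at hJ; omega
  have h6 : 6 ≤ 6 ^ g * polarizationDegree δ :=
    le_trans (by norm_num) (Nat.mul_le_mul (Nat.pow_le_pow_right (by norm_num) hg) (Nat.one_le_iff_ne_zero.mpr hd))
  omega

/-- **(9a-COUNT) the hyperplane count `hcountQ` of `exists_isFrameOn_of_count` for ONE frame rigidification over an
algebraically closed field of characteristic `0`, above MFK's threshold `N > 6^g·d·√(g!)`**: from the `Ω`-embedding package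
★ `IsFrameRigidification.exists_embedding_over_field` ((i) closed immersion `j`, (ii) `j` over `ι` — in `Proj.map` form by ★
`projectiveSpaceSpec_isoPullback_hom_snd`, (iii) `dim = g`, (iv) a coordinate hyperplane `V₊(x_{a₀})` off `j(η)`, (v) symmetry and
`h⁰(k D₀) = (6k)^g·d`), (vi) ★ `IsFrameRigidification.formDivisor_avoids_genericPoint` («`j(A)` on no hyperplane»), the degree
`deg (D₀ · (D₀^{g-1} ∩ [A])) = g!·6^g·d` (★ `degree_hyperplaneSection_iter_fundamental_eq_of_forall_h0_eq`), `(m+1)·r < N²`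
(`card_mul_lt_sq_of_threshold`) and the Chow-ring count `count_lt_of_package`.
[cite: MumfordFogartyKirwan1994, Ch. 7 §3 Prop. 7.7, proof (p. 138)] [cite: MumfordFogartyKirwan1994, Ch. 7 §3 Cor. 7.8 (p. 139)] -/
theorem count_lt_of_isFrameRigidification {Ω : Type} [Field Ω] [CharZero Ω] [IsAlgClosed Ω] [NeZero N]
    (hg : 0 < g) (hJ : Nat.card J + 1 = 6 ^ g * polarizationDegree δ)
    (hN : 6 ^ g * polarizationDegree δ * (Nat.sqrt (Nat.factorial g) + 1) + 1 ≤ N)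
    (Q : PolarizedAbelianSchemeWithLevel g N δ (Spec (.of Ω))) {ι : Q.A.X.left ⟶ projectiveSpaceInt J}
    (hι : Q.IsFrameRigidification J ι) (c : (Fin g ⊕ Fin g → ZMod N) → Fin (Nat.card J + 1))
    (hc : ∀ a, preU ((Q.A.sectionPow Q.level.σ a).left ≫ ι : Spec (.of Ω) ⟶ projectiveSpaceInt J) (c a) = ⊤)
    (f : Module.Dual Ω (Fin (Nat.card J + 1) → Ω)) (hf : f ≠ 0) :
    (Nat.card J + 1) * Nat.card {a : Fin g ⊕ Fin g → ZMod N // f (fun i => (Scheme.ΓSpecIso (.of Ω)).hom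
        (rs (hc a).ge (homRatio ((Q.A.sectionPow Q.level.σ a).left ≫ ι) (c a) i))) = 0} <
      Fintype.card (Fin g ⊕ Fin g → ZMod N) := by
  obtain ⟨n, rfl⟩ : ∃ n, g = n + 1 := ⟨g - 1, by omega⟩
  haveI : Infinite Ω := IsAlgClosed.instInfinite
  obtain ⟨j, hjci, hP6, hdim, ⟨a₀, hX₀⟩, hv⟩ := hι.exists_embedding_over_field
  haveI := hjci
  letI : Algebra intU.{0} Ω := (intCast Ω).toAlgebra
  letI := MvPolynomial.gradedAlgebra (σ := Fin (Nat.card J + 1)) (R := intU.{0})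
  letI := MvPolynomial.gradedAlgebra (σ := Fin (Nat.card J + 1)) (R := Ω)
  -- (ii) in the `Proj.map (ℤ[x] → Ω[x])` form of `count_lt_of_package`
  have hj : j.left ≫ Proj.map (ProjBaseChangeRing.mapGraded intU.{0} Ω (Fin (Nat.card J + 1)))
      (ProjBaseChangeRing.irrelevant_le_map intU.{0} Ω (Fin (Nat.card J + 1))) = ι := by
    rw [← projectiveSpaceSpec_isoPullback_hom_snd]
    exact hP6
  have hdim' : height (genericPoint ↥Q.A.toAffine.toAbelianVariety.X.left) = ((n + 1 : ℕ) : ℕ∞) := hdim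
  obtain ⟨hsym, hh0⟩ := hv (X a₀) (Segre.X_mem Ω a₀) (MvPolynomial.X_ne_zero a₀) hX₀
  -- (C4): `deg (D₀ · (D₀^{n} ∩ [A])) = g! · 6^g · d` from `h⁰(k D₀) = (6k)^g · d`
  have hdeg := degree_hyperplaneSection_iter_fundamental_eq_of_forall_h0_eq j (Segre.X_mem Ω a₀)
    (MvPolynomial.X_ne_zero a₀) hX₀ hdim' (a := 6 ^ (n + 1) * polarizationDegree δ) (CartierDivisor.LinEquiv.refl _)
    (fun k hk => by rw [hh0 k hk, mul_pow]; ring)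
  exact count_lt_of_package J Q c hc j hj (one_le_card_of_card_add_one_eq J hg hJ) rfl hdim' (Segre.X_mem Ω a₀)
    (MvPolynomial.X_ne_zero a₀) hX₀ hsym (IsFrameRigidification.formDivisor_avoids_genericPoint Q hι j hP6) hdeg.le
    (card_mul_lt_sq_of_threshold J hJ hN le_rfl) f hf

/-- **(9a) EVERY GEOMETRIC TRIPLE IS `R`-FRAMED above the explicit threshold `6^g·d·(⌊√(g!)⌋+1) + 1 ≤ N`**
([MumfordFogartyKirwan1994] Prop. 7.7 «every geometric point of `H` is in some `U_R`», with Cor. 7.8's bound): the `hcov`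
letter of `forall_exists_isFrameOn_of_count` with its count hypothesis DISCHARGED.
[cite: MumfordFogartyKirwan1994, Ch. 7 §3 Prop. 7.7 (p. 138)] [cite: MumfordFogartyKirwan1994, Ch. 7 §3 Cor. 7.8 (p. 139)] -/
theorem forall_exists_isFrameOn_of_threshold [NeZero N] [Finite J] (hg : 0 < g)
    (hJ : Nat.card J + 1 = 6 ^ g * polarizationDegree δ)
    (hN : 6 ^ g * polarizationDegree δ * (Nat.sqrt (Nat.factorial g) + 1) + 1 ≤ N) :
    ∀ ⦃Ω : Type⦄ [Field Ω] [IsAlgClosed Ω] (_ : Spec (.of Ω) ⟶ Spec (.of ℚ))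
      (Q : PolarizedAbelianSchemeWithLevel g N δ (Spec (.of Ω))),
      ∃ R : Fin (Nat.card J + 2) → (Fin g ⊕ Fin g → ZMod N), IsFrameOn J Q R :=
  forall_exists_isFrameOn_of_count J hJ fun Ω _ _ πΩ Q _ hι c hc f hf => by
    haveI : CharZero Ω := charZero_of_specHom πΩ (𝟙 _)
    exact count_lt_of_isFrameRigidification J hg hJ hN Q hι c hc f hf

/-- **THE F-12 CORE `hF9a`, CLOSED** — the binder `hF9a` of ★ `exists_threshold_siegelFineModuliScheme_of_cores` VERBATIM, with
the threshold `β(g, δ) := 6^g·d·(⌊√(g!)⌋+1) + 1` ([MumfordFogartyKirwan1994] Cor. 7.8: `n > 6^g·d·√(g!)`; Prop. 7.7: every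
geometric triple with level-`n` structure, `n ≥ β`, is `R`-framed for some `(m+2)`-sub-tuple `R` of its marked points).
[cite: MumfordFogartyKirwan1994, Ch. 7 §3 Prop. 7.7 (p. 138) and Cor. 7.8 (p. 139)] -/
theorem exists_threshold_forall_exists_isFrameOn :
    ∃ β : (g : ℕ) → (Fin g → ℕ) → ℕ, ∀ (g N : ℕ) (δ : Fin g → ℕ) (J : Type) [Finite J],
      0 < g → IsPolarizationType δ → 3 ≤ N → Nat.card J + 1 = 6 ^ g * polarizationDegree δ → β g δ ≤ N →
      ∀ ⦃Ω : Type⦄ [Field Ω] [IsAlgClosed Ω] (_ : Spec (.of Ω) ⟶ Spec (.of ℚ))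
        (Q : PolarizedAbelianSchemeWithLevel g N δ (Spec (.of Ω))),
        ∃ R : Fin (Nat.card J + 2) → (Fin g ⊕ Fin g → ZMod N), IsFrameOn J Q R := by
  refine ⟨fun g δ => 6 ^ g * polarizationDegree δ * (Nat.sqrt (Nat.factorial g) + 1) + 1,
    fun g N δ J _ hg _ hN3 hJ hβ => ?_⟩
  haveI : NeZero N := ⟨by omega⟩
  exact forall_exists_isFrameOn_of_threshold J hg hJ hβ

end PolarizedAbelianSchemeWithLevel

end Literature.AlgebraicGeometry.AbelianSchemes

end
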